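import Summits.AnomalousDissipation.AnomalousDissipation.Theorems.SawtoothPulseCascadeK1LocalisedCascadeClassBlocksCTGH
import Summits.AnomalousDissipation.AnomalousDissipation.Theorems.SawtoothPulseCascadeK1LocalisedCascadeRatioBlocksCT

/-!
# K1loc — helper: RATIO CLASSES OVER FIBRE BLOCKS IN ALL-ORDERS CORNER-TRACE GRADE («CT-GEO»; port of `…RatioBlocksCTE`)

Helper file of the prover lane on the crux `K1LocalisedCascade` (stmt-AnomalousDissipation-19491), route `SawtoothPulseCascade`
(S-D fibre ledger, corner-trace track; finding F-p1g9-1, memo v15).  `…RatioBlocksCTE.tsum_ratioClass_{v,h}step_blocks_ctE_le`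
re-run over `…ClassBlocksCTG{V,H}`: a ratio class `Σ'[X ≤ |k₀| ∧ u|k₀| ≤ v|k₁|]` (V) / `Σ'[Λ₀ ≤ |k₀| ∧ u|k₁| ≤ v|k₀|]` (H) of the
iterate through the half-step, fibre blocks `[Λ_m, Λ_{m+1})`, each with the BOX window `⌊vΛ_{m+1}/u⌋` of its top fibre (so the
all-orders kernel runs with one window per block), box trapezoid (plateau `L_m`, ramps `R_m`, `L_m + R_m ≥ 2`),
`⌊vΛ_{m+1}/u⌋ + (L_m+R_m) + 1 ≤ Λ_mG`; scalar bounds `A, β*, ρ*, Z` as hypotheses: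
`class ≤ (√(A + β*/2) + √(ρ*/2 + Z) + √feed)² + tail²`.
No definitions; no statement about the crux. [cite: Grafakos2014, Prop. 3.1.2 (5), Prop. 3.2.7 (3)] [problem: turb]
-/

-- `Summit.<Summit>.<Problem>`: single-conjunct summit, the duplicate namespace segment is deliberate.
set_option linter.dupNamespace false

noncomputable section

namespace Summit.AnomalousDissipation.AnomalousDissipation.Theorems.SawtoothPulseCascade.K1Window

open MeasureTheory Set Filter Topology UnitAddTorus Function Complex Metric
open scoped Real ENNReal
open Literature.Analysis Literature.Analysis.FunctionSpaces Literature.Analysis.FunctionSpaces.Torus Literature.Analysis.FluidPDE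
open Literature.Analysis.FluidPDE.ShearStage
open Literature.Analysis.FluidPDE.SawtoothCascade Literature.Analysis.FluidPDE.SawtoothCascade.CascadeParams
open Summit.AnomalousDissipation.AnomalousDissipation.Theorems.SawtoothPulseCascade.K1Start
open Summit.AnomalousDissipation.AnomalousDissipation.Theorems.SawtoothPulseCascade.K1Flat
open Summit.AnomalousDissipation.AnomalousDissipation.Theorems.SawtoothPulseCascade.K1Ledger.From

section Cascade

variable (P : CascadeParams)

/-- **A RATIO CLASS OF `a_{j+1}` THROUGH THE V HALF-STEP, SUMMED OVER FIBRE BLOCKS, CT-GEO GRADE, AGGREGATE TRACKED ENERGY** (see the file header; port of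
`…RatioBlocksOsc.tsum_ratioClass_vstep_blocks_osc_le`). [cite: Grafakos2014, Prop. 3.1.2 (5), Prop. 3.2.7 (3)] -/
theorem tsum_ratioClass_vstep_blocks_ctg_le {G : ℕ} (hγ : P.γ = G) (hδ₀ : 0 < P.δ₀) (hd : 0 < P.d) (hN₀ : 1 ≤ P.N₀)
    (hρN : 1 ≤ P.ρN) (a b : ℕ → UnitAddTorus (Fin 2) → ℝ) (has : ∀ j, IsSmooth (a j)) (h0 : a 0 = datum)
    (hb : ∀ j, b j = a j ∘ shearMap 0 1 (amp ⟨P.U j, P.U_periodic j, P.contDiff_U (P.δ_pos hδ₀ hd j)⟩ P.γ))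
    (hab : ∀ j, a (j + 1) = b j ∘ shearMap 1 0 (amp ⟨P.U j, P.U_periodic j, P.contDiff_U (P.δ_pos hδ₀ hd j)⟩ P.γ))
    (j : ℕ) {u v X : ℕ} (hu : 0 < u) (hv : 0 < v)
    (Λb : ℕ → ℕ) (hΛb : Monotone Λb) (hΛ0 : 1 ≤ Λb 0) (Mb : ℕ) (hΛX : v * Λb 0 ≤ u * X)
    (L R : ℕ → ℕ) (hR : ∀ m, 0 < R m) (hLR : ∀ m, 2 ≤ L m + R m)
    (hΛQ : ∀ m, v * Λb (m + 1) / u + (L m + R m) + 1 ≤ Λb m * G) {po : ℕ} (hp : 1 ≤ po) {εg : ℝ} (hεg : 0 < εg)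
    {M ε : ℝ} (hM : 1 ≤ M) (hMδ : M * P.δ j < π / 2) (hε : Real.exp (-(M ^ 2 / 2)) ≤ ε)
    {u' v' Y : ℕ} (hfeed : ∀ m, u' * Λb (m + 1) ≤ v' * (L m + 1)) (hY : ∀ m, Y ≤ L m + 1)
    {A βs ρs Z : ℝ} (hβs : 0 ≤ βs) (hρs : 0 ≤ ρs)
    (hA : ∑ m ∈ Finset.range Mb, (1 + εg) * ((P.N j : ℝ) ^ 2 / π ^ 2) *
              (8 * ((Λb m : ℝ) * G - (((L m + R m : ℕ) : ℝ) - 1)) ^ 2 / (((Λb m : ℝ) * G - (((L m + R m : ℕ) : ℝ) - 1)) ^ 2 - ((v * Λb (m + 1) / u : ℕ) : ℝ) ^ 2) ^ 2 +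
                8 * (((v * Λb (m + 1) / u : ℕ) : ℝ) + 1 / 2) / (P.N j * (((Λb m : ℝ) * G - (((L m + R m : ℕ) : ℝ) - 1)) ^ 2 - (((v * Λb (m + 1) / u : ℕ) : ℝ) + 1 / 2) ^ 2))) *
              ((Real.sqrt ((2 * L m + R m : ℕ) * R m) / R m * 1) ^ 2 / 2 + (Real.sqrt ((2 * L m + R m : ℕ) * R m) / R m * 1) ^ 2 / 2) ≤ A)
    (hβ : ∀ m ∈ Finset.range Mb, (1 + εg⁻¹) * ((P.N j : ℝ) ^ 2 / π ^ 2) * (4 / (((Λb m * G - v * Λb (m + 1) / u - (L m + R m) : ℕ) : ℝ)) ^ 2 *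
              (1 / ((((Λb m * G - v * Λb (m + 1) / u - (L m + R m) : ℕ) : ℝ)) + ((L m + R m : ℕ) : ℝ)) ^ (2 * po) +
                1 / (P.N j * ((((Λb m * G - v * Λb (m + 1) / u - (L m + R m) : ℕ) : ℝ)) + ((L m + R m : ℕ) : ℝ)) ^ (2 * po - 1)))) *
              ((2 * ((L m + R m : ℕ) : ℝ) / P.N j + 1) * ((L m + R m : ℕ) : ℝ) ^ (2 * po)) ≤ βs)
    (hρ : ∀ m ∈ Finset.range Mb, (π * ((Λb (m + 1) * G : ℕ) : ℝ) * ε / P.N j) ^ 2 ≤ ρs)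
    (hZ : ∑ m ∈ Finset.range Mb, 8 * M * P.δ j / π * ((Real.sqrt ((2 * L m + R m : ℕ) * R m) / R m * 1) ^ 2 / 2 +
        (Real.sqrt ((2 * L m + R m : ℕ) * R m) / R m * 1) ^ 2 / 2) ≤ Z) :
    ∑' k : Fin 2 → ℤ, (if (X : ℤ) ≤ |k 0| ∧ (u : ℤ) * |k 0| ≤ (v : ℤ) * |k 1| then (1 : ℝ) else 0) *
        ‖mFourierCoeff (fun x => (a (j + 1) x : ℂ)) k‖ ^ 2 ≤
      (Real.sqrt (A + βs / 2) + Real.sqrt (ρs / 2 + Z) +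
          Real.sqrt (∑' k : Fin 2 → ℤ, (if (Y : ℤ) ≤ |k 0| ∧ (u' : ℤ) * |k 1| ≤ (v' : ℤ) * |k 0| then (1 : ℝ) else 0) *
            ‖mFourierCoeff (fun x => (b j x : ℂ)) k‖ ^ 2)) ^ 2 +
        ((1 + P.γ) ^ (2 * (j + 1)) / Λb Mb) ^ 2 := by
  classical
  -- the plateau and the window
  set W : Finset (Fin 2 → ℤ) :=
    ((Finset.Icc (-((v * Λb Mb : ℕ) : ℤ)) (v * Λb Mb : ℕ) ×ˢ Finset.Icc (-(Λb Mb : ℤ)) (Λb Mb)).filter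
      (fun q : ℤ × ℤ => (X : ℤ) ≤ |q.1| ∧ (u : ℤ) * |q.1| ≤ v * |q.2| ∧ (Λb 0 : ℤ) ≤ |q.2| ∧ |q.2| < (Λb Mb : ℤ))).image
      (fun q : ℤ × ℤ => (fun i : Fin 2 => if i = 0 then q.1 else q.2)) with hWdef
  have hWall : ∀ k ∈ W, (X : ℤ) ≤ |k 0| ∧ (u : ℤ) * |k 0| ≤ v * |k 1| ∧ (Λb 0 : ℤ) ≤ |k 1| ∧ |k 1| < (Λb Mb : ℤ) := by
    intro k hk
    obtain ⟨q, hq, rfl⟩ := Finset.mem_image.mp hk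
    have h := (Finset.mem_filter.mp hq).2
    simpa using h
  have hvz : (0 : ℤ) < v := by exact_mod_cast hv
  have hqW : ∀ k : Fin 2 → ℤ, ((X : ℤ) ≤ |k 0| ∧ (u : ℤ) * |k 0| ≤ (v : ℤ) * |k 1|) → |k 1| < (Λb Mb : ℤ) → k ∈ W := by
    intro k hk h2
    have hk1 : (Λb 0 : ℤ) ≤ |k 1| := by
      have hΛXz : (v : ℤ) * Λb 0 ≤ u * X := by exact_mod_cast hΛX
      have huz : (0 : ℤ) ≤ u := by positivity
      nlinarith [hk.1, hk.2, mul_le_mul_of_nonneg_left hk.1 huz]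
    have hk0 : |k 0| ≤ ((v * Λb Mb : ℕ) : ℤ) := by
      push_cast
      have h3 : (v : ℤ) * |k 1| ≤ v * Λb Mb := mul_le_mul_of_nonneg_left h2.le hvz.le
      have huz : (1 : ℤ) ≤ u := by exact_mod_cast hu
      nlinarith [abs_nonneg (k 0), hk.2]
    refine Finset.mem_image.mpr ⟨(k 0, k 1), ?_, ?_⟩
    · refine Finset.mem_filter.mpr ⟨Finset.mem_product.mpr ⟨Finset.mem_Icc.mpr ?_, Finset.mem_Icc.mpr ?_⟩,
        hk.1, hk.2, hk1, h2⟩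
      · exact ⟨by linarith [neg_abs_le (k 0)], by linarith [le_abs_self (k 0)]⟩
      · exact ⟨by linarith [neg_abs_le (k 1), h2.le], by linarith [le_abs_self (k 1), h2.le]⟩
    · funext i; fin_cases i <;> simp
  have hW : ∀ k ∈ W, (Λb 0 : ℤ) ≤ |k 1| ∧ |k 1| < (Λb Mb : ℤ) := fun k hk =>
    ⟨(hWall k hk).2.2.1, (hWall k hk).2.2.2⟩
  have hWK : ∀ m, ∀ k ∈ W, (Λb m : ℤ) ≤ |k 1| → |k 1| < (Λb (m + 1) : ℤ) →
      |k 0| ≤ (((fun m : ℕ => v * Λb (m + 1) / u) m : ℕ) : ℤ) := by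
    intro m k hk _ h2
    have huv := (hWall k hk).2.1
    have huz : (0 : ℤ) < u := by exact_mod_cast hu
    show |k 0| ≤ ((v * Λb (m + 1) / u : ℕ) : ℤ)
    rw [Int.natCast_div, Int.le_ediv_iff_mul_le huz]
    push_cast
    have hvz : (0 : ℤ) ≤ v := by positivity
    nlinarith [mul_le_mul_of_nonneg_left h2.le hvz]
  have hWsym : ∀ k ∈ W, Function.update k 1 (-k 1) ∈ W := by
    intro k hk
    obtain ⟨q, hq, rfl⟩ := Finset.mem_image.mp hk
    have h := Finset.mem_filter.mp hq
    simp only [Finset.mem_product, Finset.mem_Icc] at h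
    obtain ⟨⟨⟨h1, h2⟩, h3, h4⟩, h5⟩ := h
    refine Finset.mem_image.mpr ⟨(q.1, -q.2), ?_, ?_⟩
    · refine Finset.mem_filter.mpr ⟨Finset.mem_product.mpr ⟨Finset.mem_Icc.mpr ?_, Finset.mem_Icc.mpr ?_⟩, ?_⟩
      · exact ⟨h1, h2⟩
      · exact ⟨by omega, by omega⟩
      · simpa only [abs_neg] using h5
    · funext i; fin_cases i <;> simp
  have hPf : ∀ m, ∀ k : Fin 2 → ℤ, (Λb m : ℤ) ≤ |k 1| → |k 1| < (Λb (m + 1) : ℤ) → (L m : ℤ) < |k 0| →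
      ((Y : ℤ) ≤ |k 0| ∧ (u' : ℤ) * |k 1| ≤ (v' : ℤ) * |k 0|) := by
    intro m k _ h2 h3
    have hf : ((u' * Λb (m + 1) : ℕ) : ℤ) ≤ ((v' * (L m + 1) : ℕ) : ℤ) := by exact_mod_cast hfeed m
    have hYm : ((Y : ℕ) : ℤ) ≤ ((L m + 1 : ℕ) : ℤ) := by exact_mod_cast hY m
    push_cast at hf hYm
    have h3' : (L m : ℤ) + 1 ≤ |k 0| := h3
    refine ⟨by linarith, ?_⟩
    have hu'0 : (0 : ℤ) ≤ u' := by positivity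
    have hv'0 : (0 : ℤ) ≤ v' := by positivity
    nlinarith [mul_le_mul_of_nonneg_left h2.le hu'0, mul_le_mul_of_nonneg_left h3' hv'0]
  exact tsum_class_vstep_blocks_ctg_le P hγ hδ₀ hd hN₀ hρN a b has h0 hb hab j _ Λb hΛb hΛ0 Mb W hqW hW L R (fun m : ℕ => v * Λb (m + 1) / u) hR hLR hWK
    (fun m _ => hΛQ m) hWsym hp hεg hM hMδ hε _ hPf hβs hρs hA hβ hρ hZ

/-- **A RATIO CLASS OF `b_j` THROUGH THE H HALF-STEP, SUMMED OVER FIBRE BLOCKS, CT-GEO GRADE, AGGREGATE TRACKED ENERGY** (port of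
`…RatioBlocksOsc.tsum_ratioClass_hstep_blocks_osc_le`). [cite: Grafakos2014, Prop. 3.1.2 (5), Prop. 3.2.7 (3)] -/
theorem tsum_ratioClass_hstep_blocks_ctg_le {G : ℕ} (hγ : P.γ = G) (hδ₀ : 0 < P.δ₀) (hd : 0 < P.d) (hN₀ : 1 ≤ P.N₀)
    (hρN : 1 ≤ P.ρN) (a b : ℕ → UnitAddTorus (Fin 2) → ℝ) (has : ∀ j, IsSmooth (a j)) (h0 : a 0 = datum)
    (hb : ∀ j, b j = a j ∘ shearMap 0 1 (amp ⟨P.U j, P.U_periodic j, P.contDiff_U (P.δ_pos hδ₀ hd j)⟩ P.γ))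
    (hab : ∀ j, a (j + 1) = b j ∘ shearMap 1 0 (amp ⟨P.U j, P.U_periodic j, P.contDiff_U (P.δ_pos hδ₀ hd j)⟩ P.γ))
    (j : ℕ) {u v : ℕ} (hu : 0 < u) (hv : 0 < v)
    (Λb : ℕ → ℕ) (hΛb : Monotone Λb) (hΛ0 : 1 ≤ Λb 0) (Mb : ℕ)
    (L R : ℕ → ℕ) (hR : ∀ m, 0 < R m) (hLR : ∀ m, 2 ≤ L m + R m)
    (hΛQ : ∀ m, v * Λb (m + 1) / u + (L m + R m) + 1 ≤ Λb m * G) {po : ℕ} (hp : 1 ≤ po) {εg : ℝ} (hεg : 0 < εg)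
    {M ε : ℝ} (hM : 1 ≤ M) (hMδ : M * P.δ j < π / 2) (hε : Real.exp (-(M ^ 2 / 2)) ≤ ε)
    {u' v' Y : ℕ} (hfeed : ∀ m, u' * Λb (m + 1) ≤ v' * (L m + 1)) (hY : Y ≤ Λb 0)
    {A βs ρs Z : ℝ} (hβs : 0 ≤ βs) (hρs : 0 ≤ ρs)
    (hA : ∑ m ∈ Finset.range Mb, (1 + εg) * ((P.N j : ℝ) ^ 2 / π ^ 2) *
              (8 * ((Λb m : ℝ) * G - (((L m + R m : ℕ) : ℝ) - 1)) ^ 2 / (((Λb m : ℝ) * G - (((L m + R m : ℕ) : ℝ) - 1)) ^ 2 - ((v * Λb (m + 1) / u : ℕ) : ℝ) ^ 2) ^ 2 +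
                8 * (((v * Λb (m + 1) / u : ℕ) : ℝ) + 1 / 2) / (P.N j * (((Λb m : ℝ) * G - (((L m + R m : ℕ) : ℝ) - 1)) ^ 2 - (((v * Λb (m + 1) / u : ℕ) : ℝ) + 1 / 2) ^ 2))) *
              ((Real.sqrt ((2 * L m + R m : ℕ) * R m) / R m * 1) ^ 2 / 2 + (Real.sqrt ((2 * L m + R m : ℕ) * R m) / R m * 1) ^ 2 / 2) ≤ A)
    (hβ : ∀ m ∈ Finset.range Mb, (1 + εg⁻¹) * ((P.N j : ℝ) ^ 2 / π ^ 2) * (4 / (((Λb m * G - v * Λb (m + 1) / u - (L m + R m) : ℕ) : ℝ)) ^ 2 *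
              (1 / ((((Λb m * G - v * Λb (m + 1) / u - (L m + R m) : ℕ) : ℝ)) + ((L m + R m : ℕ) : ℝ)) ^ (2 * po) +
                1 / (P.N j * ((((Λb m * G - v * Λb (m + 1) / u - (L m + R m) : ℕ) : ℝ)) + ((L m + R m : ℕ) : ℝ)) ^ (2 * po - 1)))) *
              ((2 * ((L m + R m : ℕ) : ℝ) / P.N j + 1) * ((L m + R m : ℕ) : ℝ) ^ (2 * po)) ≤ βs)
    (hρ : ∀ m ∈ Finset.range Mb, (π * ((Λb (m + 1) * G : ℕ) : ℝ) * ε / P.N j) ^ 2 ≤ ρs)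
    (hZ : ∑ m ∈ Finset.range Mb, 8 * M * P.δ j / π * ((Real.sqrt ((2 * L m + R m : ℕ) * R m) / R m * 1) ^ 2 / 2 +
        (Real.sqrt ((2 * L m + R m : ℕ) * R m) / R m * 1) ^ 2 / 2) ≤ Z) :
    ∑' k : Fin 2 → ℤ, (if (Λb 0 : ℤ) ≤ |k 0| ∧ (u : ℤ) * |k 1| ≤ (v : ℤ) * |k 0| then (1 : ℝ) else 0) *
        ‖mFourierCoeff (fun x => (b j x : ℂ)) k‖ ^ 2 ≤
      (Real.sqrt (A + βs / 2) + Real.sqrt (ρs / 2 + Z) +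
          Real.sqrt (∑' k : Fin 2 → ℤ, (if (Y : ℤ) ≤ |k 0| ∧ (u' : ℤ) * |k 0| ≤ (v' : ℤ) * |k 1| then (1 : ℝ) else 0) *
            ‖mFourierCoeff (fun x => (a j x : ℂ)) k‖ ^ 2)) ^ 2 +
        ((1 + P.γ) ^ (2 * j) / Λb Mb) ^ 2 := by
  classical
  -- the plateau and the window
  set W : Finset (Fin 2 → ℤ) :=
    ((Finset.Icc (-(Λb Mb : ℤ)) (Λb Mb) ×ˢ Finset.Icc (-((v * Λb Mb : ℕ) : ℤ)) (v * Λb Mb : ℕ)).filter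
      (fun q : ℤ × ℤ => (Λb 0 : ℤ) ≤ |q.1| ∧ (u : ℤ) * |q.2| ≤ v * |q.1| ∧ |q.1| < (Λb Mb : ℤ))).image
      (fun q : ℤ × ℤ => (fun i : Fin 2 => if i = 0 then q.1 else q.2)) with hWdef
  have hWall : ∀ k ∈ W, (Λb 0 : ℤ) ≤ |k 0| ∧ (u : ℤ) * |k 1| ≤ v * |k 0| ∧ |k 0| < (Λb Mb : ℤ) := by
    intro k hk
    obtain ⟨q, hq, rfl⟩ := Finset.mem_image.mp hk
    have h := (Finset.mem_filter.mp hq).2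
    simpa using h
  have hvz : (0 : ℤ) < v := by exact_mod_cast hv
  have hqW : ∀ k : Fin 2 → ℤ, ((Λb 0 : ℤ) ≤ |k 0| ∧ (u : ℤ) * |k 1| ≤ (v : ℤ) * |k 0|) → |k 0| < (Λb Mb : ℤ) → k ∈ W := by
    intro k hk h2
    have hk1 : |k 1| ≤ ((v * Λb Mb : ℕ) : ℤ) := by
      push_cast
      have h3 : (v : ℤ) * |k 0| ≤ v * Λb Mb := mul_le_mul_of_nonneg_left h2.le hvz.le
      have huz : (1 : ℤ) ≤ u := by exact_mod_cast hu
      nlinarith [abs_nonneg (k 1), hk.2]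
    refine Finset.mem_image.mpr ⟨(k 0, k 1), ?_, ?_⟩
    · refine Finset.mem_filter.mpr ⟨Finset.mem_product.mpr ⟨Finset.mem_Icc.mpr ?_, Finset.mem_Icc.mpr ?_⟩,
        hk.1, hk.2, h2⟩
      · exact ⟨by linarith [neg_abs_le (k 0), h2.le], by linarith [le_abs_self (k 0), h2.le]⟩
      · exact ⟨by linarith [neg_abs_le (k 1)], by linarith [le_abs_self (k 1)]⟩
    · funext i; fin_cases i <;> simp
  have hW : ∀ k ∈ W, (Λb 0 : ℤ) ≤ |k 0| ∧ |k 0| < (Λb Mb : ℤ) := fun k hk =>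
    ⟨(hWall k hk).1, (hWall k hk).2.2⟩
  have hWK : ∀ m, ∀ k ∈ W, (Λb m : ℤ) ≤ |k 0| → |k 0| < (Λb (m + 1) : ℤ) →
      |k 1| ≤ (((fun m : ℕ => v * Λb (m + 1) / u) m : ℕ) : ℤ) := by
    intro m k hk _ h2
    have huv := (hWall k hk).2.1
    have huz : (0 : ℤ) < u := by exact_mod_cast hu
    show |k 1| ≤ ((v * Λb (m + 1) / u : ℕ) : ℤ)
    rw [Int.natCast_div, Int.le_ediv_iff_mul_le huz]
    push_cast
    have hvz : (0 : ℤ) ≤ v := by positivity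
    nlinarith [mul_le_mul_of_nonneg_left h2.le hvz]
  have hWsym : ∀ k ∈ W, Function.update k 0 (-k 0) ∈ W := by
    intro k hk
    obtain ⟨q, hq, rfl⟩ := Finset.mem_image.mp hk
    have h := Finset.mem_filter.mp hq
    simp only [Finset.mem_product, Finset.mem_Icc] at h
    obtain ⟨⟨⟨h1, h2⟩, h3, h4⟩, h5⟩ := h
    refine Finset.mem_image.mpr ⟨(-q.1, q.2), ?_, ?_⟩
    · refine Finset.mem_filter.mpr ⟨Finset.mem_product.mpr ⟨Finset.mem_Icc.mpr ?_, Finset.mem_Icc.mpr ?_⟩, ?_⟩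
      · exact ⟨by omega, by omega⟩
      · exact ⟨h3, h4⟩
      · simpa only [abs_neg] using h5
    · funext i; fin_cases i <;> simp
  have hPf : ∀ m, ∀ k : Fin 2 → ℤ, (Λb m : ℤ) ≤ |k 0| → |k 0| < (Λb (m + 1) : ℤ) → (L m : ℤ) < |k 1| →
      ((Y : ℤ) ≤ |k 0| ∧ (u' : ℤ) * |k 0| ≤ (v' : ℤ) * |k 1|) := by
    intro m k h1 h2 h3
    have hf : ((u' * Λb (m + 1) : ℕ) : ℤ) ≤ ((v' * (L m + 1) : ℕ) : ℤ) := by exact_mod_cast hfeed m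
    have hY' : ((Y : ℕ) : ℤ) ≤ ((Λb 0 : ℕ) : ℤ) := by exact_mod_cast hY
    have hm0 : ((Λb 0 : ℕ) : ℤ) ≤ ((Λb m : ℕ) : ℤ) := by exact_mod_cast hΛb (Nat.zero_le m)
    push_cast at hf
    have h3' : (L m : ℤ) + 1 ≤ |k 1| := h3
    refine ⟨by linarith, ?_⟩
    have hu'0 : (0 : ℤ) ≤ u' := by positivity
    have hv'0 : (0 : ℤ) ≤ v' := by positivity
    nlinarith [mul_le_mul_of_nonneg_left h2.le hu'0, mul_le_mul_of_nonneg_left h3' hv'0]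
  exact tsum_class_hstep_blocks_ctg_le P hγ hδ₀ hd hN₀ hρN a b has h0 hb hab j _ Λb hΛb hΛ0 Mb W hqW hW L R (fun m : ℕ => v * Λb (m + 1) / u) hR hLR hWK
    (fun m _ => hΛQ m) hWsym hp hεg hM hMδ hε _ hPf hβs hρs hA hβ hρ hZ

end Cascade

end Summit.AnomalousDissipation.AnomalousDissipation.Theorems.SawtoothPulseCascade.K1Window
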